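import Mathlib
import Literature.NumberTheory.Transcendental.OneMotiveToricProofs

/-!
# Route `TateNomes`, crux `NomeHygiene`, line `integer_shift_rebase`:
# stub `stub_shiftCoincidence` — the Key Lemma (at most finitely many Möbius coincidences along
# the transcendental cusp direction `−1/2πi`)

(item stmt-Schanuel-17298, route route-Schanuel-TateNomes; skeleton
`Summits/Schanuel/Schanuel/Cruxes/NomeHygiene/Lines/integer_shift_rebase.lean`, registered stub
`stub_shiftCoincidence`, proved here verbatim — name and uncurried signature.)

## Statement

If `(1, 2πi, β)` is `ℚ`-linearly independent then for every `p ∈ ℂ` the set of rational shifts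
`t` for which `τ_t := (β − t)/2πi` and `p` are related by an element of `GL₂⁺(ℚ)` — in the
polynomial form `τ' (c τ + d) = a τ + b` with `a d − b c > 0`, in either direction — is finite.

## Proof

Write `τ_t = x + t·y` with `x = β/2πi` and `y = −1/2πi`; `y` is transcendental (Lindemann, tree
`Literature.NumberTheory.Transcendental.transcendental_two_pi_I`) and `1, x, y` are `ℚ`-linearly
independent (multiply a relation by `2πi`).  The relation `R(α, β) :⇔ ∃ a b c d ∈ ℚ, ad − bc > 0,
β (c α + d) = a α + b` is symmetric (`mob_symm`: adjugate matrix) and transitive (`mob_trans`: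
matrix product) as POLYNOMIAL identities — no non-vanishing of `cα + d` is needed.  Hence if the
set were infinite, three distinct bad shifts `t₁, t₂, t₃` would give pairwise relations
`(x+t_j y)(c(x+t_i y)+d) = a(x+t_i y)+b`.  For such a pair `c = 0` is impossible (`pair_affine`:
it forces `d = a ≠ 0`, `b = 0`, `t_i = t_j` by the independence of `1, x, y`), so
`(x+t_i y)(x+t_j y) = b/c + ((a−d)/c) x + ((a t_i − d t_j)/c) y` is a rational affine form in
`x, y`.  Differences of the three products give `D (y²) ` and `D' (x y)` as rational affine forms
with `D, D' ≠ 0` (`key_contra`), and eliminating `x` yields a rational cubic with leading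
coefficient `D'·D ≠ 0` vanishing at `y` — contradicting the transcendence of `y`.
-/

noncomputable section

-- `Summit.Schanuel.Schanuel.…` is the mandated summit/sub-problem namespace (single-conjunct summit), hence:
set_option linter.dupNamespace false

namespace Summit.Schanuel.Schanuel.Theorems.TateNomesNomeHygiene

open Complex

/-! ## The Möbius relation as polynomial identities -/

/-- Symmetry of the `GL₂⁺(ℚ)`-relation in polynomial form (adjugate matrix). -/
theorem mob_symm {α β : ℂ} {a b c d : ℚ} (hdet : 0 < a * d - b * c)
    (h : β * ((c : ℂ) * α + d) = (a : ℂ) * α + b) :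
    ∃ a' b' c' d' : ℚ, 0 < a' * d' - b' * c' ∧ α * ((c' : ℂ) * β + d') = (a' : ℂ) * β + b' := by
  refine ⟨d, -b, -c, a, ?_, ?_⟩
  · have e : d * a - -b * -c = a * d - b * c := by ring
    rw [e]
    exact hdet
  · push_cast
    linear_combination (-1 : ℂ) * h

/-- Transitivity of the `GL₂⁺(ℚ)`-relation in polynomial form (matrix product; the identity is
obtained by multiplying the second relation by `cα + d`, so no non-vanishing is needed). -/
theorem mob_trans {α β γ : ℂ} {a b c d a' b' c' d' : ℚ} (hdet : 0 < a * d - b * c)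
    (hdet' : 0 < a' * d' - b' * c')
    (h1 : β * ((c : ℂ) * α + d) = (a : ℂ) * α + b)
    (h2 : γ * ((c' : ℂ) * β + d') = (a' : ℂ) * β + b') :
    ∃ A B C D : ℚ, 0 < A * D - B * C ∧ γ * ((C : ℂ) * α + D) = (A : ℂ) * α + B := by
  refine ⟨a' * a + b' * c, a' * b + b' * d, c' * a + d' * c, c' * b + d' * d, ?_, ?_⟩
  · have e : (a' * a + b' * c) * (c' * b + d' * d) - (a' * b + b' * d) * (c' * a + d' * c) =
        (a' * d' - b' * c') * (a * d - b * c) := by ring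
    rw [e]
    exact mul_pos hdet' hdet
  · push_cast
    linear_combination ((c : ℂ) * α + d) * h2 - (γ * c' - a') * h1

/-! ## The three-point rigidity -/

/-- A relation between two distinct points `x + t y`, `x + t' y` of the line has `c ≠ 0` and
therefore expresses the product `(x + t y)(x + t' y)` as a rational affine form in `x, y`. -/
theorem pair_affine {x y : ℂ}
    (hL : ∀ q₀ q₁ q₂ : ℚ, (q₀ : ℂ) + q₁ * x + q₂ * y = 0 → q₀ = 0 ∧ q₁ = 0 ∧ q₂ = 0)
    {t t' : ℚ} (htt : t ≠ t')
    (h : ∃ a b c d : ℚ, 0 < a * d - b * c ∧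
      (x + (t' : ℂ) * y) * ((c : ℂ) * (x + (t : ℂ) * y) + d) = (a : ℂ) * (x + (t : ℂ) * y) + b) :
    ∃ r₀ r₁ r₂ : ℚ, (x + (t : ℂ) * y) * (x + (t' : ℂ) * y) = (r₀ : ℂ) + r₁ * x + r₂ * y := by
  obtain ⟨a, b, c, d, hdet, h⟩ := h
  by_cases hc : c = 0
  · subst hc
    exfalso
    obtain ⟨hb, hda, hdt⟩ := hL (-b) (d - a) (d * t' - a * t) (by push_cast; linear_combination h)
    have hd : d = a := by linarith
    rw [hd] at hdet hdt
    have ha : a ≠ 0 := by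
      rintro rfl
      simp at hdet
    have hmul : a * (t' - t) = 0 := by linear_combination hdt
    rcases mul_eq_zero.1 hmul with h1 | h1
    · exact ha h1
    · exact htt (by linarith)
  · refine ⟨b / c, (a - d) / c, (a * t - d * t') / c, ?_⟩
    have hc' : (c : ℂ) ≠ 0 := by exact_mod_cast hc
    have key : (x + (t : ℂ) * y) * (x + (t' : ℂ) * y) * c =
        (b : ℂ) + (a - d) * x + (a * t - d * t') * y := by
      linear_combination h
    push_cast
    field_simp
    linear_combination key

/-- Three pairwise-related distinct points `x + tᵢ y` on a line with `1, x, y` `ℚ`-independent force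
`y` to be algebraic (a rational cubic with non-zero leading coefficient vanishes at `y`). -/
theorem key_contra {x y : ℂ}
    (hL : ∀ q₀ q₁ q₂ : ℚ, (q₀ : ℂ) + q₁ * x + q₂ * y = 0 → q₀ = 0 ∧ q₁ = 0 ∧ q₂ = 0)
    (hy : Transcendental ℚ y) {t₁ t₂ t₃ : ℚ} (h12 : t₁ ≠ t₂) (h13 : t₁ ≠ t₃) (h23 : t₂ ≠ t₃)
    (r12 : ∃ a b c d : ℚ, 0 < a * d - b * c ∧
      (x + (t₂ : ℂ) * y) * ((c : ℂ) * (x + (t₁ : ℂ) * y) + d) = (a : ℂ) * (x + (t₁ : ℂ) * y) + b)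
    (r13 : ∃ a b c d : ℚ, 0 < a * d - b * c ∧
      (x + (t₃ : ℂ) * y) * ((c : ℂ) * (x + (t₁ : ℂ) * y) + d) = (a : ℂ) * (x + (t₁ : ℂ) * y) + b)
    (r23 : ∃ a b c d : ℚ, 0 < a * d - b * c ∧
      (x + (t₃ : ℂ) * y) * ((c : ℂ) * (x + (t₂ : ℂ) * y) + d) = (a : ℂ) * (x + (t₂ : ℂ) * y) + b) :
    False := by
  obtain ⟨α₀, α₁, α₂, hA⟩ := pair_affine hL h12 r12
  obtain ⟨β₀, β₁, β₂, hB⟩ := pair_affine hL h13 r13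
  obtain ⟨γ₀, γ₁, γ₂, hC⟩ := pair_affine hL h23 r23
  -- `D y² = n₀ + n₁ x + n₂ y` with `D = (t₁ - t₂)(t₂ - t₃)(t₁ - t₃) ≠ 0`
  set D : ℚ := (t₁ - t₂) * (t₂ - t₃) * (t₁ - t₃) with hD
  set n₀ : ℚ := (t₁ - t₃) * (α₀ - β₀) - (t₂ - t₃) * (α₀ - γ₀) with hn₀
  set n₁ : ℚ := (t₁ - t₃) * (α₁ - β₁) - (t₂ - t₃) * (α₁ - γ₁) with hn₁
  set n₂ : ℚ := (t₁ - t₃) * (α₂ - β₂) - (t₂ - t₃) * (α₂ - γ₂) with hn₂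
  have hD0 : D ≠ 0 := by
    rw [hD]
    exact mul_ne_zero (mul_ne_zero (sub_ne_zero.2 h12) (sub_ne_zero.2 h23)) (sub_ne_zero.2 h13)
  have H1 : (D : ℂ) * y ^ 2 = (n₀ : ℂ) + n₁ * x + n₂ * y := by
    rw [hD, hn₀, hn₁, hn₂]
    push_cast
    linear_combination ((t₁ : ℂ) - t₃) * hA - ((t₁ : ℂ) - t₃) * hB
      - ((t₂ : ℂ) - t₃) * hA + ((t₂ : ℂ) - t₃) * hC
  -- `D' (x y) = m₀ + m₁ x + m₂ y` with `D' = (t₂ - t₃) D ≠ 0`: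
  -- from `(t₂ - t₃)(x y + t₁ y²) = A - B` and `D y² = N`.
  set D' : ℚ := (t₂ - t₃) * D with hD'
  set m₀ : ℚ := D * (α₀ - β₀) - t₁ * (t₂ - t₃) * n₀ with hm₀
  set m₁ : ℚ := D * (α₁ - β₁) - t₁ * (t₂ - t₃) * n₁ with hm₁
  set m₂ : ℚ := D * (α₂ - β₂) - t₁ * (t₂ - t₃) * n₂ with hm₂
  have hD'0 : D' ≠ 0 := by
    rw [hD']
    exact mul_ne_zero (sub_ne_zero.2 h23) hD0
  have H2 : (D' : ℂ) * (x * y) = (m₀ : ℂ) + m₁ * x + m₂ * y := by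
    rw [hD', hm₀, hm₁, hm₂]
    push_cast
    linear_combination (D : ℂ) * hA - (D : ℂ) * hB - (t₁ : ℂ) * ((t₂ : ℂ) - t₃) * H1
  -- eliminate `x`: a rational cubic with leading coefficient `D' D ≠ 0` vanishes at `y`
  apply hy
  refine ⟨Polynomial.C (D' * D) * Polynomial.X ^ 3 + Polynomial.C (-(D' * n₂ + m₁ * D)) *
      Polynomial.X ^ 2 + Polynomial.C (-(D' * n₀ + m₂ * n₁ - m₁ * n₂)) * Polynomial.X +
      Polynomial.C (-(m₀ * n₁ - m₁ * n₀)), ?_, ?_⟩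
  · intro hp
    have h3 := congrArg (fun q => Polynomial.coeff q 3) hp
    simp only [Polynomial.coeff_add, Polynomial.coeff_C_mul, Polynomial.coeff_X_pow,
      Polynomial.coeff_C, Polynomial.coeff_X, Polynomial.coeff_zero] at h3
    norm_num at h3
    rcases h3 with h3 | h3
    · exact hD'0 h3
    · exact hD0 h3
  · simp only [map_add, map_mul, map_pow, map_neg, Polynomial.aeval_X, Polynomial.aeval_C,
      eq_ratCast]
    push_cast
    linear_combination ((D' : ℂ) * y - m₁) * H1 + (n₁ : ℂ) * H2

/-! ## The registered stub -/

/-- **`stub_shiftCoincidence`** (Key Lemma of line `integer_shift_rebase`, registered on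
stmt-Schanuel-17298; name and signature verbatim). -/
theorem stub_shiftCoincidence :
    ∀ (β p : ℂ), LinearIndependent ℚ ![(1 : ℂ), 2 * (Real.pi : ℂ) * Complex.I, β] →
      Set.Finite {t : ℚ | ∃ a b c d : ℚ, 0 < a * d - b * c ∧
        ((β - (t : ℂ)) / (2 * (Real.pi : ℂ) * Complex.I) * ((c : ℂ) * p + (d : ℂ)) =
            (a : ℂ) * p + (b : ℂ) ∨
         p * ((c : ℂ) * ((β - (t : ℂ)) / (2 * (Real.pi : ℂ) * Complex.I)) + (d : ℂ)) =
            (a : ℂ) * ((β - (t : ℂ)) / (2 * (Real.pi : ℂ) * Complex.I)) + (b : ℂ))} := by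
  intro β p hβ
  set T : ℂ := 2 * (Real.pi : ℂ) * Complex.I with hT
  have hT0 : T ≠ 0 := by
    rw [hT]
    exact Complex.two_pi_I_ne_zero
  -- nome coordinates on the line: `τ_t = x + t y`
  set x : ℂ := β / T with hx
  set y : ℂ := -1 / T with hy
  have hτ : ∀ t : ℚ, (β - (t : ℂ)) / T = x + (t : ℂ) * y := by
    intro t
    rw [hx, hy]
    field_simp
    ring
  -- `1, x, y` are `ℚ`-independent (multiply a relation by `T = 2πi`)
  have hL : ∀ q₀ q₁ q₂ : ℚ, (q₀ : ℂ) + q₁ * x + q₂ * y = 0 → q₀ = 0 ∧ q₁ = 0 ∧ q₂ = 0 := by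
    intro q₀ q₁ q₂ h
    have h' : ((-q₂ : ℚ) : ℂ) * 1 + (q₀ : ℂ) * T + (q₁ : ℂ) * β = 0 := by
      have hm := congrArg (fun z => z * T) h
      simp only [zero_mul] at hm
      rw [hx, hy] at hm
      field_simp at hm
      push_cast
      linear_combination hm
    have h0 := (Fintype.linearIndependent_iff.1 hβ) ![-q₂, q₀, q₁] (by
      rw [Fin.sum_univ_three]
      simp only [Matrix.cons_val_zero, Matrix.cons_val_one, Matrix.head_cons,
        Matrix.cons_val_two, Matrix.tail_cons, Rat.smul_def]
      exact h')
    have e0 := h0 0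
    have e1 := h0 1
    have e2 := h0 2
    simp only [Matrix.cons_val_zero, Matrix.cons_val_one, Matrix.head_cons,
      Matrix.cons_val_two, Matrix.tail_cons, neg_eq_zero] at e0 e1 e2
    exact ⟨e1, e2, e0⟩
  -- `y = -1/2πi` is transcendental (Lindemann)
  have hyT : Transcendental ℚ y := by
    intro halg
    apply Literature.NumberTheory.Transcendental.transcendental_two_pi_I
    have e : (2 * Real.pi * I : ℂ) = -y⁻¹ := by
      rw [hy]
      field_simp
      rw [hT]
    rw [e]
    exact halg.inv.neg
  -- normalise every bad shift to a relation "`p` from `τ_t`"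
  set S : Set ℚ := {t : ℚ | ∃ a b c d : ℚ, 0 < a * d - b * c ∧
        ((β - (t : ℂ)) / T * ((c : ℂ) * p + (d : ℂ)) = (a : ℂ) * p + (b : ℂ) ∨
         p * ((c : ℂ) * ((β - (t : ℂ)) / T) + (d : ℂ)) =
            (a : ℂ) * ((β - (t : ℂ)) / T) + (b : ℂ))} with hS
  have hN : ∀ t : ℚ, t ∈ S → ∃ a b c d : ℚ, 0 < a * d - b * c ∧
      p * ((c : ℂ) * (x + (t : ℂ) * y) + d) = (a : ℂ) * (x + (t : ℂ) * y) + b := by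
    intro t ht
    rw [hS, Set.mem_setOf_eq] at ht
    obtain ⟨a, b, c, d, hdet, h | h⟩ := ht
    · rw [hτ t] at h
      exact mob_symm hdet h
    · rw [hτ t] at h
      exact ⟨a, b, c, d, hdet, h⟩
  have hP : ∀ t t' : ℚ, t ∈ S → t' ∈ S → ∃ a b c d : ℚ, 0 < a * d - b * c ∧
      (x + (t' : ℂ) * y) * ((c : ℂ) * (x + (t : ℂ) * y) + d) = (a : ℂ) * (x + (t : ℂ) * y) + b := by
    intro t t' ht ht'
    obtain ⟨a, b, c, d, hdet, h⟩ := hN t ht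
    obtain ⟨a', b', c', d', hdet', h'⟩ := hN t' ht'
    obtain ⟨a'', b'', c'', d'', hdet'', h''⟩ := mob_symm hdet' h'
    exact mob_trans hdet hdet'' h h''
  -- three distinct bad shifts would contradict `key_contra`
  by_contra hinf
  have hSi : S.Infinite := hinf
  obtain ⟨t₁, ht₁, -⟩ := hSi.exists_notMem_finset ∅
  obtain ⟨t₂, ht₂, ht₂n⟩ := hSi.exists_notMem_finset {t₁}
  obtain ⟨t₃, ht₃, ht₃n⟩ := hSi.exists_notMem_finset {t₁, t₂}
  simp only [Finset.mem_singleton, Finset.mem_insert, not_or] at ht₂n ht₃n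
  exact key_contra hL hyT (Ne.symm ht₂n) (Ne.symm ht₃n.1) (Ne.symm ht₃n.2)
    (hP t₁ t₂ ht₁ ht₂) (hP t₁ t₃ ht₁ ht₃) (hP t₂ t₃ ht₂ ht₃)

end Summit.Schanuel.Schanuel.Theorems.TateNomesNomeHygiene

end
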